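import Literature.NumberTheory.DiophantineGeometry.GenEllJInvReduction
import Literature.NumberTheory.LocalFields.PadicFiniteSubextensions
import HarnessLib

/-!
# The named fact `krasner_finite_subextensions` DISCHARGED; the "WLOG (∗^{j-inv})" reduction unconditional

Proof-only companion of `GenEllJInvReduction.lean` (abc-iut campaign S; statement by seat abc-iut-S4,
discharge by seat abc-iut-S-d3). The named fact

> `krasner_finite_subextensions : ∀ (p : ℕ) [Fact p.Prime] (d : ℕ),`
> `  {K : IntermediateField ℚ_[p] (PadicAlgCl p) | FiniteDimensional ℚ_[p] K ∧ Module.finrank ℚ_[p] K ≤ d}.Finite`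

("the number of extensions of degree at most `d` is finite", Bombieri–Gubler, proof of Prop. 4.5.3,
after M. Krasner) is, word for word, the tree's theorem
`Literature.NumberTheory.LocalFields.finite_setOf_intermediateField_finrank_le`
(`LocalFields/PadicFiniteSubextensions.lean`: Krasner's lemma + continuity of roots + compactness,
by induction over base fields). Hence:

* `krasner_finite_subextensions_holds` — the fact holds;
* `vojtaIneq_of_forall_jInvBounded'`, `wlog_jInv` — S4's reduction theorems with the Krasner
  hypothesis removed: for fixed `d, ε`, Vojta's inequality on `K_V ∩ U_X(ℚ̄)^{≤d}` for all compactly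
  bounded `K_V ∋ 2` satisfying (∗^{j-inv}) implies it for ALL compactly bounded `K_V ∋ 2` — i.e. the
  hypothesis `hwlog` of `Summit.ABC.IUTFork.abc_of_corollary22` holds outright.

No new definitions; `GenEllJInvReduction.lean` is not edited.
-/

noncomputable section

namespace Literature.NumberTheory.DiophantineGeometry.GenEll

open Literature.IUT.LogVolume

/-- **Krasner's finiteness holds**: for every prime `p` and every `d`, the subextensions of `Q̄_p/ℚ_p` of
degree `≤ d` form a finite set — the named fact `krasner_finite_subextensions` DISCHARGED by the tree's
`Literature.NumberTheory.LocalFields.finite_setOf_intermediateField_finrank_le`.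
[cite: BombieriGubler2006, proof of Prop 4.5.3] -/
theorem krasner_finite_subextensions_holds : krasner_finite_subextensions :=
  fun p _ d => Literature.NumberTheory.LocalFields.finite_setOf_intermediateField_finrank_le p d

/-- **The "WLOG (∗^{j-inv})" reduction, unconditional** (S4's `vojtaIneq_of_forall_jInvBounded` with the
Krasner hypothesis discharged): for fixed `d, ε`, if `ht ≲ (1+ε)(log-diff + log-cond)` holds on
`K_V ∩ U_X(ℚ̄)^{≤d}` for every compactly bounded `K_V` with `2` in its support satisfying (∗^{j-inv}),
then it holds for every compactly bounded `K_V` with `2` in its support.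
[cite: BombieriGubler2006, proof of Prop 4.5.3] -/
theorem vojtaIneq_of_forall_jInvBounded' (d : ℕ) (ε : ℝ)
    (h : ∀ D : CBData, D.SupportContains {2} → Cor22.JInvBounded D → VojtaIneq D.toSet d ε)
    (D : CBData) (hD : D.SupportContains {2}) : VojtaIneq D.toSet d ε :=
  vojtaIneq_of_forall_jInvBounded krasner_finite_subextensions_holds d ε h D hD

/-- The hypothesis `hwlog` of `Summit.ABC.IUTFork.abc_of_corollary22`, unconditionally (S4's
`wlog_jInv_of_krasner` with the fact discharged). [cite: BombieriGubler2006, proof of Prop 4.5.3] -/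
theorem wlog_jInv (d : ℕ) (ε : ℝ) :
    (∀ D : CBData, D.SupportContains {2} → Cor22.JInvBounded D → VojtaIneq D.toSet d ε) →
      ∀ D : CBData, D.SupportContains {2} → VojtaIneq D.toSet d ε :=
  wlog_jInv_of_krasner krasner_finite_subextensions_holds d ε

end Literature.NumberTheory.DiophantineGeometry.GenEll

end
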